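import Literature.MathematicalPhysics.QuantumFieldTheory.Balaban1983to89.B9Eq326ConjugatedDeltaATwoBackgrounds
import Literature.MathematicalPhysics.QuantumFieldTheory.Balaban1983to89.B9Eq386GreenAnalyticPencilEnergy

/-!
# `Balaban1983to89.B9Eq326ConjugatedDeltaATwoBackgroundsPencil` — T. Bałaban, *Propagators for lattice gauge theories in a background field*, Commun. Math.
# Phys. **99** (1985) 389–434 [Balaban1985BackgroundPropagators] Thm 3.4 p. 400, (3.52)–(3.53) p. 400, (3.84)–(3.86) p. 407, Thm 3.11 p. 416, with [Kato1966]
# Ch. VII §4: **THE TWO CONJUGATED `Δ_a`-STRUCTURES AS A LINEAR PENCIL — ALL ORDERS FROM PRIMITIVE LETTERS: for `H(z) = H_κ(U) + z(H_κ(V) − H_κ(U))`,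
# `‖∂_zⁿ H(z)⁻¹|₀‖ ≤ n!·(γ′ − R₁Θ)⁻¹∕R₁ⁿ` on every `R₁ < γ′∕Θ`, and `‖H_κ(V)⁻¹ − H_κ(U)⁻¹‖ ≤ (γ′ − R₁Θ)⁻¹∕(R₁ − 1)`, with `γ′ = min(¼, γ∕8)` and `Θ` the
# displayed polynomial in (CDA)'s letters and the CONJUGATED two-background letters `δ₁, δ₂, δ_R, δ_Q, δ_K` — NO weight comparison, NO unconjugated letter** —
# the junction of this lineage's `B9Eq326ConjugatedDeltaATwoBackgrounds` (N52 road (α): the letters) with `B9Eq386GreenAnalyticPencilEnergy` (N53: the pencil)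

statement-level skeleton of published theorems with citation tags; proofs where landed; nothing here is a claim about the Yang–Mills mass gap

CITATION HEADER (lean-in-tree rule).  Audit cell `pub-balaban`, sub-cell `t4`, BINDER row NE9; filed by NE9 formalisation-swarm LEAF PROVER 01
(`b2b-balaban-t4-ne9-formalise-leaf-01`, gen 88); the junction t4-ne9-idea-1 gen 152's N53 card names («I-3's binder list read as `S₀ := H_κ(U)`, `D := H_κ(V) −
H_κ(U)` with I-2's `Θ`»; cell journal 2026-08-25 l.63736).  Imports this lineage's `B9Eq326ConjugatedDeltaATwoBackgrounds` (`norm_inner_conjH_sub_conjH_le_weightU`,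
through it `…EnergyWeight.coerciveN_k`, `rightInv_eq_greenK`) and `B9Eq386GreenAnalyticPencilEnergy` (`norm_iteratedDeriv_inverse_pencil_le`,
`norm_inverse_add_sub_inverse_le`, `norm_inverse_pencil_le`, `inverse_apply_eq_greenK`, `rePos_of_coerciveN`).  Sources READ first-hand in the held text layer
(`paper:balaban1985-cmp99-background-propagators`, journal page = PDF page + 388): p. 400 Thm 3.4 *«extend to configurations U′U … as analytic functions of A …
describing these analytic extensions as small perturbations of the operators depending on U only»*, p. 407 (3.86), p. 416 Thm 3.11.  Print's analyticity is
the operator-norm Neumann series (3.86); the form-currency pencil is the ROUTE's substitute (`t4/ROUTES-NE9.md` §L1.4, N52 ∕ N53); nothing of print's radius is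
asserted.

WHAT IS PROVED (sorry-free; proof lane — no `def`; [folklore] composition BY NAME; `𝕜 = ℂ`).  Hypotheses = (CDA) §2's binder list at `U` (for `coerciveN_k`),
the conjugated structure at `V` with `V`'s projection letters, ONE set of scalars on the energy window, and the eight CONJUGATED two-background letters; the
pencil is `S₀ := H_κ(U)`, `D := H_κ(V) − H_κ(U)` as continuous linear maps (`LinearMap.toContinuousLinearMap`).
* **`norm_iteratedDeriv_inverse_conjH_pencil_le`** — `0 < R₁`, `R₁Θ < γ′` ⟹ `‖iteratedDeriv n (z ↦ (S₀ + z•D)⁻¹) 0‖ ≤ n!·(γ′ − R₁Θ)⁻¹∕R₁ⁿ`.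
* **`norm_inverse_conjH_pencil_le`** — `‖(S₀ + z•D)⁻¹‖ ≤ (γ′ − R₁Θ)⁻¹` on `‖z‖ ≤ R₁`.
* **`norm_inverse_conjH_sub_inverse_conjH_le`** — `1 < R₁`, `R₁Θ < γ′` ⟹ `‖H_κ(V)⁻¹ − H_κ(U)⁻¹‖ ≤ (γ′ − R₁Θ)⁻¹∕(R₁ − 1)` (the algebra inverses).
* **`inverse_conjH_apply_eq_rightInv`** — `H_κ(U)G = 1` ⟹ `(H_κ(U))⁻¹y = Gy`: the algebra inverse IS (CDT)'s right inverse `S∘G₁,k(U)∘S⁻¹`.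
MODEL ∕ HONEST SCOPE.  (M1) abstract letters over `ℂ`; finite-dimensional spaces (completeness of `E` is found by instance search from `FiniteDimensional ℂ E`, so the pencil file's `[CompleteSpace E]` costs the consumer nothing).  (M2) DISPLAYED: `γ` (Thm 3.11), every (CDA) letter, the conjugated
two-background letters; `R₁` free.  (M3) the first order here is `(γ′ − R₁Θ)⁻¹∕(R₁ − 1)`, WORSE than `…TwoBackgrounds`' `(Θ∕γ′)(1 + δ_N)γ′⁻¹` by a constant but with
NO unconjugated letter and NO weight comparison; all orders are new.  (M4) the LINEAR operator pencil, not the GROUP pencil `z ↦ H_κ(V·e^{zA})`; no lattice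
object, no rate, no window evaluated.  NOT NE9 (cell pub-balaban: NE9 NOT PRINTED ∕ NOT PROVED; «NE9 ⇐ the named binders»; row WALLED ON A MODEL (O-NE9-1; #5
UNRULED); spine PROVED 0∕9; rung (B)+1 on a finite T⁴ — NOT infinite volume, NOT mass gap, NOT BetaPertH, NOT Clay).  HONEST DEPENDENCY (cell line): continuum
YM on T⁴ ⇐ BetaPertH ∧ nine spine estimates (0/9 proved); BetaPertH ⇐ (D1) ∧ (D4) ∧ CAP+tail; G-an2-4 gates asym, D1 and NE2/3/4.  NEW file; nothing modified.
Net new unproved facts: 0.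
-/

noncomputable section

open scoped InnerProductSpace ComplexConjugate

namespace Literature.MathematicalPhysics.QuantumFieldTheory.Balaban1983to89.B9Eq326ConjugatedDeltaATwoBackgroundsPencil

open B9Eq326ConjugatedDeltaAEnergyWeight (weightU_nonneg norm_le_weightU coerciveN_k rightInv_eq_greenK)
open B9Eq326ConjugatedDeltaATwoBackgrounds (norm_inner_conjH_sub_conjH_le_weightU)
open B9Eq386GreenAnalyticPencilEnergy (rePos_of_coerciveN inverse_apply_eq_greenK norm_inverse_pencil_le norm_iteratedDeriv_inverse_pencil_le
  norm_inverse_add_sub_inverse_le)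

variable {E : Type*} [NormedAddCommGroup E] [InnerProductSpace ℂ E] [FiniteDimensional ℂ E]
  {P : Type*} [NormedAddCommGroup P] [InnerProductSpace ℂ P] [FiniteDimensional ℂ P]
  {S : Type*} [NormedAddCommGroup S] [InnerProductSpace ℂ S] [FiniteDimensional ℂ S]
  {F : Type*} [NormedAddCommGroup F] [InnerProductSpace ℂ F] [FiniteDimensional ℂ F]

section Pencil

variable {B₁U : E →ₗ[ℂ] P} {B₂U : E →ₗ[ℂ] S} {RU RV : S →ₗ[ℂ] S} {QU : E →ₗ[ℂ] F} {KU HU : E →ₗ[ℂ] E}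
  {a γ β βK pK ρ CP : ℝ}
  {B₁kU B₁kV : E →ₗ[ℂ] P} {B₁k'U B₁k'V : P →ₗ[ℂ] E} {B₂kU B₂kV : E →ₗ[ℂ] S} {B₂k'U B₂k'V : S →ₗ[ℂ] E} {RkU RkV : S →ₗ[ℂ] S}
  {QkU QkV : E →ₗ[ℂ] F} {Qk'U Qk'V : F →ₗ[ℂ] E} {KkU KkV HkU HkV : E →ₗ[ℂ] E}
  (ha : 0 ≤ a) (hβ : 0 ≤ β) (hρ : 0 ≤ ρ) (hρ8 : ρ ≤ 1 / 8) (hCP : 0 ≤ CP)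
  (small' : 3 / 4 * pK + (21 + 3 * a) * β ^ 2 + 4 * β * CP + 2 * ρ * CP ^ 2 + βK ≤ γ / 8)
  -- the structure at `U`
  (hRsqU : ∀ s, RCLike.re ⟪s, RU s⟫_ℂ = ‖RU s‖ ^ 2) (hR1U : ∀ s, ‖RU s‖ ≤ ‖s‖)
  (hHU : ∀ f, HU f = LinearMap.adjoint B₁U (B₁U f) + LinearMap.adjoint B₂U (RU (B₂U f)) + KU f + ((a : ℝ) : ℂ) • LinearMap.adjoint QU (QU f))
  (coerciveU : ∀ f, γ * ‖f‖ ^ 2 ≤ RCLike.re ⟪f, HU f⟫_ℂ) (hKreU : ∀ f, -(pK * ‖f‖ ^ 2) ≤ RCLike.re ⟪f, KU f⟫_ℂ)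
  (hPU : ∀ f, ‖B₂U f - RU (B₂U f)‖ ≤ CP * ‖f‖)
  (dB₁U : ∀ f, ‖B₁kU f - B₁U f‖ ≤ β * ‖f‖) (dB₁'U : ∀ p, ‖B₁k'U p - LinearMap.adjoint B₁U p‖ ≤ β * ‖p‖)
  (dB₂U : ∀ f, ‖B₂kU f - B₂U f‖ ≤ β * ‖f‖) (dB₂'U : ∀ s, ‖B₂k'U s - LinearMap.adjoint B₂U s‖ ≤ β * ‖s‖)
  (dRU : ∀ s, ‖RkU s - RU s‖ ≤ ρ * ‖s‖)
  (dQU : ∀ f, ‖QkU f - QU f‖ ≤ β * ‖f‖) (dQ'U : ∀ g, ‖Qk'U g - LinearMap.adjoint QU g‖ ≤ β * ‖g‖)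
  (dKU : ∀ f, ‖KkU f - KU f‖ ≤ βK * ‖f‖)
  (hHkU : ∀ f, HkU f = B₁k'U (B₁kU f) + B₂k'U (RkU (B₂kU f)) + KkU f + ((a : ℝ) : ℂ) • Qk'U (QkU f))
  -- the conjugated structure at `V` and `V`'s projection letters
  (hR1V : ∀ s, ‖RV s‖ ≤ ‖s‖) (dRV : ∀ s, ‖RkV s - RV s‖ ≤ ρ * ‖s‖)
  (hHkV : ∀ f, HkV f = B₁k'V (B₁kV f) + B₂k'V (RkV (B₂kV f)) + KkV f + ((a : ℝ) : ℂ) • Qk'V (QkV f))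
  -- the CONJUGATED two-background difference letters
  {δ₁ δ₂ δR δQ δK : ℝ} (hδ₁ : 0 ≤ δ₁) (hδ₂ : 0 ≤ δ₂) (hδR : 0 ≤ δR) (hδQ : 0 ≤ δQ) (hδK : 0 ≤ δK)
  (tB₁ : ∀ f, ‖B₁kV f - B₁kU f‖ ≤ δ₁ * ‖f‖) (tB₁' : ∀ p, ‖B₁k'V p - B₁k'U p‖ ≤ δ₁ * ‖p‖)
  (tB₂ : ∀ f, ‖B₂kV f - B₂kU f‖ ≤ δ₂ * ‖f‖) (tB₂' : ∀ s, ‖B₂k'V s - B₂k'U s‖ ≤ δ₂ * ‖s‖)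
  (tR : ∀ s, ‖RkV s - RkU s‖ ≤ δR * ‖s‖)
  (tQ : ∀ f, ‖QkV f - QkU f‖ ≤ δQ * ‖f‖) (tQ' : ∀ g, ‖Qk'V g - Qk'U g‖ ≤ δQ * ‖g‖)
  (tK : ∀ f, ‖KkV f - KkU f‖ ≤ δK * ‖f‖)
  -- the radius of the pencil
  {R₁ : ℝ} (hR₁ : 0 < R₁)
  (hgap : R₁ * (((1 + β) * δ₁ + δ₁ * (1 + β) + δ₁ * δ₁) +
      ((1 + CP + β) * ((1 + ρ) * δ₂ + δR * (1 + CP + β)) + δ₂ * ((1 + ρ) * (1 + CP + β)) + δ₂ * ((1 + ρ) * δ₂ + δR * (1 + CP + β))) +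
      δK + ((Real.sqrt a + |a| * β) * δQ + δQ * (Real.sqrt a + |a| * β) + |a| * (δQ * δQ))) < min (1 / 4) (γ / 8))

/-- The pencil's `hco` letter: `γ′·N_U(u)² ≤ re⟪u, S₀u⟫` for `S₀ = H_κ(U)` as a continuous linear map (`…EnergyWeight.coerciveN_k`). [folklore]
[cite: Balaban1985BackgroundPropagators, (3.26) p.395, (3.49) p.399, Thm 3.11 p.416] -/
private theorem hco_aux (ha : 0 ≤ a) (hβ : 0 ≤ β) (hρ : 0 ≤ ρ) (hρ8 : ρ ≤ 1 / 8) (hCP : 0 ≤ CP)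
    (small' : 3 / 4 * pK + (21 + 3 * a) * β ^ 2 + 4 * β * CP + 2 * ρ * CP ^ 2 + βK ≤ γ / 8)
    (hRsqU : ∀ s, RCLike.re ⟪s, RU s⟫_ℂ = ‖RU s‖ ^ 2) (hR1U : ∀ s, ‖RU s‖ ≤ ‖s‖)
    (hHU : ∀ f, HU f = LinearMap.adjoint B₁U (B₁U f) + LinearMap.adjoint B₂U (RU (B₂U f)) + KU f + ((a : ℝ) : ℂ) • LinearMap.adjoint QU (QU f))
    (coerciveU : ∀ f, γ * ‖f‖ ^ 2 ≤ RCLike.re ⟪f, HU f⟫_ℂ) (hKreU : ∀ f, -(pK * ‖f‖ ^ 2) ≤ RCLike.re ⟪f, KU f⟫_ℂ)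
    (hPU : ∀ f, ‖B₂U f - RU (B₂U f)‖ ≤ CP * ‖f‖)
    (dB₁U : ∀ f, ‖B₁kU f - B₁U f‖ ≤ β * ‖f‖) (dB₁'U : ∀ p, ‖B₁k'U p - LinearMap.adjoint B₁U p‖ ≤ β * ‖p‖)
    (dB₂U : ∀ f, ‖B₂kU f - B₂U f‖ ≤ β * ‖f‖) (dB₂'U : ∀ s, ‖B₂k'U s - LinearMap.adjoint B₂U s‖ ≤ β * ‖s‖)
    (dRU : ∀ s, ‖RkU s - RU s‖ ≤ ρ * ‖s‖)
    (dQU : ∀ f, ‖QkU f - QU f‖ ≤ β * ‖f‖) (dQ'U : ∀ g, ‖Qk'U g - LinearMap.adjoint QU g‖ ≤ β * ‖g‖)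
    (dKU : ∀ f, ‖KkU f - KU f‖ ≤ βK * ‖f‖)
    (hHkU : ∀ f, HkU f = B₁k'U (B₁kU f) + B₂k'U (RkU (B₂kU f)) + KkU f + ((a : ℝ) : ℂ) • Qk'U (QkU f)) (u : E) :
    min (1 / 4) (γ / 8) * Real.sqrt (‖B₁U u‖ ^ 2 + ‖RU (B₂U u)‖ ^ 2 + a * ‖QU u‖ ^ 2 + ‖u‖ ^ 2) ^ 2 ≤
      RCLike.re ⟪u, (LinearMap.toContinuousLinearMap HkU : E →L[ℂ] E) u⟫_ℂ := by
  rw [LinearMap.coe_toContinuousLinearMap']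
  exact coerciveN_k B₁U B₂U RU QU KU HU a γ β βK pK ρ CP B₁kU B₁k'U B₂kU B₂k'U RkU QkU Qk'U KkU HkU ha hβ hρ hCP hRsqU hR1U hHU coerciveU hKreU
    dB₁U dB₁'U dB₂U dB₂'U dRU dQU dQ'U dKU small' hHkU hρ8 hPU u

include ha hβ hρ hCP hR1U hPU dB₁U dB₁'U dB₂U dB₂'U dRU dQU dQ'U hHkU hR1V dRV hHkV hδ₁ hδ₂ hδR hδQ hδK tB₁ tB₁' tB₂ tB₂' tR tQ tQ' tK in
/-- The pencil's `hD` letter: `‖⟪u, Dv⟫‖ ≤ Θ·N_U(u)N_U(v)` for `D = H_κ(V) − H_κ(U)` (`…TwoBackgrounds.norm_inner_conjH_sub_conjH_le_weightU`). [folklore]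
[cite: Balaban1985BackgroundPropagators, (3.52)–(3.53) p.400, (3.84)–(3.86) p.407] -/
private theorem hD_aux (u v : E) :
    ‖⟪u, (LinearMap.toContinuousLinearMap (HkV - HkU) : E →L[ℂ] E) v⟫_ℂ‖ ≤
      (((1 + β) * δ₁ + δ₁ * (1 + β) + δ₁ * δ₁) +
          ((1 + CP + β) * ((1 + ρ) * δ₂ + δR * (1 + CP + β)) + δ₂ * ((1 + ρ) * (1 + CP + β)) + δ₂ * ((1 + ρ) * δ₂ + δR * (1 + CP + β))) +
          δK + ((Real.sqrt a + |a| * β) * δQ + δQ * (Real.sqrt a + |a| * β) + |a| * (δQ * δQ))) *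
        Real.sqrt (‖B₁U u‖ ^ 2 + ‖RU (B₂U u)‖ ^ 2 + a * ‖QU u‖ ^ 2 + ‖u‖ ^ 2) * Real.sqrt (‖B₁U v‖ ^ 2 + ‖RU (B₂U v)‖ ^ 2 + a * ‖QU v‖ ^ 2 + ‖v‖ ^ 2) := by
  rw [LinearMap.coe_toContinuousLinearMap', LinearMap.sub_apply, inner_sub_right, norm_sub_rev]
  exact norm_inner_conjH_sub_conjH_le_weightU ha hβ hρ hCP hR1U hPU dB₁U dB₁'U dB₂U dB₂'U dRU dQU dQ'U hHkU hR1V dRV hHkV hδ₁ hδ₂ hδR hδQ hδK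
    tB₁ tB₁' tB₂ tB₂' tR tQ tQ' tK u v

include ha hβ hρ hρ8 hCP small' hRsqU hR1U hHU coerciveU hKreU hPU dB₁U dB₁'U dB₂U dB₂'U dRU dQU dQ'U dKU hHkU hR1V dRV hHkV hδ₁ hδ₂ hδR hδQ hδK tB₁ tB₁'
  tB₂ tB₂' tR tQ tQ' tK hR₁ hgap in
/-- **CAUCHY AT EVERY ORDER FOR THE TWO CONJUGATED STRUCTURES**: with `S₀ = H_κ(U)`, `D = H_κ(V) − H_κ(U)`, `γ′ = min(¼, γ∕8)` and the displayed `Θ`, for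
every `0 < R₁` with `R₁Θ < γ′`: `‖iteratedDeriv n (z ↦ (S₀ + z•D)⁻¹) 0‖ ≤ n!·(γ′ − R₁Θ)⁻¹∕R₁ⁿ` — the Taylor coefficients of the conjugated propagator in the
direction `H_κ(V) − H_κ(U)` are majorised geometrically from the CONJUGATED two-background letters alone (`…AnalyticPencilEnergy.norm_iteratedDeriv_inverse_pencil_le`
with `…EnergyWeight.coerciveN_k` and `…TwoBackgrounds.norm_inner_conjH_sub_conjH_le_weightU`).  Every constant is a function of `(γ, R₁)` and the displayed
letters, hence UNIFORM on a Combes–Thomas circle `‖κ‖ = r` whenever the letters are: the read-out `B9Eq349BondBlockDecayFromCircle.norm_bondBlock_le_exp_of_uniform_circle_bound`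
then applies ORDER BY ORDER with prefactor `n!·(γ′ − R₁Θ)⁻¹R₁⁻ⁿ` and the SAME rate (t4-ne9-idea-1 g152, L-g152-8; not valued here). [folklore]
[cite: Balaban1985BackgroundPropagators, Thm 3.4 p.400, (3.86) p.407, Thm 3.11 p.416; Kato1966, Ch. VII §4] -/
theorem norm_iteratedDeriv_inverse_conjH_pencil_le (n : ℕ) :
    ‖iteratedDeriv n (fun w : ℂ => Ring.inverse ((LinearMap.toContinuousLinearMap HkU : E →L[ℂ] E) + w • (LinearMap.toContinuousLinearMap (HkV - HkU) : E →L[ℂ] E))) 0‖ ≤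
      n.factorial * (min (1 / 4) (γ / 8) - R₁ * (((1 + β) * δ₁ + δ₁ * (1 + β) + δ₁ * δ₁) +
          ((1 + CP + β) * ((1 + ρ) * δ₂ + δR * (1 + CP + β)) + δ₂ * ((1 + ρ) * (1 + CP + β)) + δ₂ * ((1 + ρ) * δ₂ + δR * (1 + CP + β))) +
          δK + ((Real.sqrt a + |a| * β) * δQ + δQ * (Real.sqrt a + |a| * β) + |a| * (δQ * δQ))))⁻¹ / R₁ ^ n :=
  norm_iteratedDeriv_inverse_pencil_le _ (weightU_nonneg B₁U B₂U RU QU a) (norm_le_weightU B₁U B₂U RU QU a ha) (by positivity) hR₁ hgap _ _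
    (hco_aux ha hβ hρ hρ8 hCP small' hRsqU hR1U hHU coerciveU hKreU hPU dB₁U dB₁'U dB₂U dB₂'U dRU dQU dQ'U dKU hHkU)
    (hD_aux ha hβ hρ hCP hR1U hPU dB₁U dB₁'U dB₂U dB₂'U dRU dQU dQ'U hHkU hR1V dRV hHkV hδ₁ hδ₂ hδR hδQ hδK tB₁ tB₁' tB₂ tB₂' tR tQ tQ' tK) n

include ha hβ hρ hρ8 hCP small' hRsqU hR1U hHU coerciveU hKreU hPU dB₁U dB₁'U dB₂U dB₂'U dRU dQU dQ'U dKU hHkU hR1V dRV hHkV hδ₁ hδ₂ hδR hδQ hδK tB₁ tB₁'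
  tB₂ tB₂' tR tQ tQ' tK hgap in
/-- **UNIFORM INVERSE BOUND ON THE DISC** for the two conjugated structures: `‖(S₀ + z•D)⁻¹‖ ≤ (γ′ − R₁Θ)⁻¹` for `‖z‖ ≤ R₁`. [folklore]
[cite: Balaban1985BackgroundPropagators, Thm 3.4 p.400, Thm 3.11 p.416; Kato1966, Ch. VII §4] -/
theorem norm_inverse_conjH_pencil_le {z : ℂ} (hz : ‖z‖ ≤ R₁) :
    ‖Ring.inverse ((LinearMap.toContinuousLinearMap HkU : E →L[ℂ] E) + z • (LinearMap.toContinuousLinearMap (HkV - HkU) : E →L[ℂ] E))‖ ≤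
      (min (1 / 4) (γ / 8) - R₁ * (((1 + β) * δ₁ + δ₁ * (1 + β) + δ₁ * δ₁) +
          ((1 + CP + β) * ((1 + ρ) * δ₂ + δR * (1 + CP + β)) + δ₂ * ((1 + ρ) * (1 + CP + β)) + δ₂ * ((1 + ρ) * δ₂ + δR * (1 + CP + β))) +
          δK + ((Real.sqrt a + |a| * β) * δQ + δQ * (Real.sqrt a + |a| * β) + |a| * (δQ * δQ))))⁻¹ :=
  norm_inverse_pencil_le _ (weightU_nonneg B₁U B₂U RU QU a) (norm_le_weightU B₁U B₂U RU QU a ha) (by positivity) hgap _ _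
    (hco_aux ha hβ hρ hρ8 hCP small' hRsqU hR1U hHU coerciveU hKreU hPU dB₁U dB₁'U dB₂U dB₂'U dRU dQU dQ'U dKU hHkU)
    (hD_aux ha hβ hρ hCP hR1U hPU dB₁U dB₁'U dB₂U dB₂'U dRU dQU dQ'U hHkU hR1V dRV hHkV hδ₁ hδ₂ hδR hδQ hδK tB₁ tB₁' tB₂ tB₂' tR tQ tQ' tK) hz

include ha hβ hρ hρ8 hCP small' hRsqU hR1U hHU coerciveU hKreU hPU dB₁U dB₁'U dB₂U dB₂'U dRU dQU dQ'U dKU hHkU hR1V dRV hHkV hδ₁ hδ₂ hδR hδQ hδK tB₁ tB₁'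
  tB₂ tB₂' tR tQ tQ' tK hgap in
/-- **THE TWO-BACKGROUND DIFFERENCE OF THE ALGEBRA INVERSES BY THE MEAN VALUE THEOREM ON THE PENCIL**: for `1 < R₁` with `R₁Θ < γ′`,
`‖H_κ(V)⁻¹ − H_κ(U)⁻¹‖ ≤ (γ′ − R₁Θ)⁻¹∕(R₁ − 1)` — NO unconjugated letter, NO weight comparison (compare `…TwoBackgrounds.norm_conjGk_sub_conjGk_le`). [folklore]
[cite: Balaban1985BackgroundPropagators, Thm 3.4 p.400, (3.86) p.407, Thm 3.11 p.416; Kato1966, Ch. VII §4] -/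
theorem norm_inverse_conjH_sub_inverse_conjH_le (hR₁1 : 1 < R₁) :
    ‖Ring.inverse (LinearMap.toContinuousLinearMap HkV : E →L[ℂ] E) - Ring.inverse (LinearMap.toContinuousLinearMap HkU : E →L[ℂ] E)‖ ≤
      (min (1 / 4) (γ / 8) - R₁ * (((1 + β) * δ₁ + δ₁ * (1 + β) + δ₁ * δ₁) +
          ((1 + CP + β) * ((1 + ρ) * δ₂ + δR * (1 + CP + β)) + δ₂ * ((1 + ρ) * (1 + CP + β)) + δ₂ * ((1 + ρ) * δ₂ + δR * (1 + CP + β))) +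
          δK + ((Real.sqrt a + |a| * β) * δQ + δQ * (Real.sqrt a + |a| * β) + |a| * (δQ * δQ))))⁻¹ / (R₁ - 1) := by
  have h := norm_inverse_add_sub_inverse_le _ (weightU_nonneg B₁U B₂U RU QU a) (norm_le_weightU B₁U B₂U RU QU a ha) (by positivity) hgap _ _
    (hco_aux ha hβ hρ hρ8 hCP small' hRsqU hR1U hHU coerciveU hKreU hPU dB₁U dB₁'U dB₂U dB₂'U dRU dQU dQ'U dKU hHkU)
    (hD_aux ha hβ hρ hCP hR1U hPU dB₁U dB₁'U dB₂U dB₂'U dRU dQU dQ'U hHkU hR1V dRV hHkV hδ₁ hδ₂ hδR hδQ hδK tB₁ tB₁' tB₂ tB₂' tR tQ tQ' tK) hR₁1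
  have e : (LinearMap.toContinuousLinearMap HkU : E →L[ℂ] E) + (LinearMap.toContinuousLinearMap (HkV - HkU) : E →L[ℂ] E) =
      (LinearMap.toContinuousLinearMap HkV : E →L[ℂ] E) := by
    rw [map_sub, add_sub_cancel]
  rwa [e] at h

end Pencil

/-- **THE ALGEBRA INVERSE IS (CDT)'s RIGHT INVERSE**: if `H` is strongly coercive in a weight dominating the norm and `HG = 1`, then
`(H : E →L E)⁻¹ y = Gy` (`…AnalyticPencilEnergy.inverse_apply_eq_greenK` + `…EnergyWeight.rightInv_eq_greenK`) — so the pencil's `z = 0, 1` members are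
`S∘G₁,k(U)∘S⁻¹`, `S∘G₁,k(V)∘S⁻¹` once (CDT)'s `conjDeltaAk_conjInv` is supplied. [folklore] [cite: Balaban1985Variational, (110) p.294; Balaban1985BackgroundPropagators, Thm 3.11 p.416] -/
theorem inverse_conjH_apply_eq_rightInv {H G : E →ₗ[ℂ] E} (N : E → ℝ) (hNn : ∀ z, ‖z‖ ≤ N z) {γ' : ℝ} (hγ' : 0 < γ')
    (hcoerN : ∀ z : E, γ' * N z ^ 2 ≤ RCLike.re ⟪z, H z⟫_ℂ) (hHG : ∀ v, H (G v) = v) (y : E) :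
    Ring.inverse (LinearMap.toContinuousLinearMap H : E →L[ℂ] E) y = G y := by
  have hpos : ∀ x : E, x ≠ 0 → 0 < RCLike.re ⟪x, ((LinearMap.toContinuousLinearMap H : E →L[ℂ] E) : E →ₗ[ℂ] E) x⟫_ℂ := fun x hx => by
    rw [ContinuousLinearMap.coe_coe, LinearMap.coe_toContinuousLinearMap']
    exact rePos_of_coerciveN N hNn hγ' hcoerN x hx
  have hpos' : ∀ x : E, x ≠ 0 → 0 < RCLike.re ⟪x, H x⟫_ℂ := rePos_of_coerciveN N hNn hγ' hcoerN
  rw [inverse_apply_eq_greenK _ hpos, rightInv_eq_greenK hpos' hHG y]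
  congr 1

end Literature.MathematicalPhysics.QuantumFieldTheory.Balaban1983to89.B9Eq326ConjugatedDeltaATwoBackgroundsPencil

end
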